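import Summits.HodgeConjecture.HodgeConjecture.Theses.NoetherLefschetzOneUp
import Summits.HodgeConjecture.HodgeConjecture.Theorems.NoetherLefschetzOneUpLevelZeroNetsStein
import Literature.AlgebraicGeometry.HodgeTheory.ArapuraFourfoldsFibredBySurfacesProofs
import Literature.AlgebraicGeometry.HodgeTheory.ArapuraSurfaceFibredFourfoldsSplit
import Literature.AlgebraicGeometry.Motives.VarietiesProjectiveSpaceProofs
import Literature.AlgebraicGeometry.Motives.VarietiesProperProofs
import Literature.AlgebraicGeometry.Motives.VarietiesGeometricallyIntegralProofs
import Literature.AlgebraicGeometry.Motives.GoodReductionSpecialFibreProofs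
import Literature.AlgebraicGeometry.Resolution.SmoothOverNormal
import Literature.AlgebraicGeometry.HodgeTheory.GysinFormalismPushforward
import Literature.NumberTheory.Transcendental.Analytification
import Literature.AlgebraicGeometry.HodgeTheory.SupportedClassesHodgeConiveauProofs
import Literature.AlgebraicGeometry.HodgeTheory.RationalClassesRingChange
import Literature.AlgebraicGeometry.HodgeTheory.ComplexConjugationHolds
import Literature.NumberTheory.Transcendental.DeRhamTheoremMultiplicative

/-!
# Route NoetherLefschetzOneUp — `LevelZeroNets` (stmt-HodgeConjecture-11602), III:
# the item from Arapura's Cor. 1.5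

`LevelZeroNets` (LEVEL ZERO: for a smooth projective complex fourfold `X` and a surjective
`f : X → ℙ²` whose fibres over the complex points off a proper Zariski-closed `T` are smooth
projective surfaces with `h^{2,0} = 0`, the rational `(2,2)`-classes of `X` lie in
algebraic ⊔ vertical classes) is Arapura 2022, Cor. 1.5 — in the tree the NAMED FACT
`Literature.AlgebraicGeometry.HodgeTheory.Arapura2022_hodgeConjecture_pgZeroSurfaceFibration`
(a genuine case of the Hodge conjecture: Leray filtration, decomposition theorem, relative Hilbert
schemes — no carrier in the tree; split record `ArapuraSurfaceFibredFourfoldsSplit`) — at `Y = ℙ²_ℂ`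
with a weaker conclusion, EXCEPT that the fact's standing hypothesis "all fibres connected" is not
an item hypothesis. This file supplies that hypothesis unconditionally and lands the item
CONDITIONAL on the named fact:

* `LevelZeroNetsStein.isIntegrallyClosed_stalk_of_isSmoothProjective` — smooth projective complex
  varieties are normal (smooth over normal is normal,
  `Resolution.isIntegrallyClosed_stalk_of_mem_smoothLocus`).
* `LevelZeroNetsStein.isPreconnected_fibre_of_isSmoothProjective_fiberOver` — the item's fibre
  hypothesis gives preconnected point-fibres over the closed points off `T` (closed points of `ℙ²_ℂ`
  are complex points, `ComplexPoints.equivClosedPoints`; the fibre over `s.pt` is the image of the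
  irreducible `X ×_{ℙ²} Spec ℂ`).
* `LevelZeroNetsStein.geometricallyConnected_of_net` — hence ALL fibres of `f` are geometrically
  connected (`geometricallyConnected_of_isPreconnected_fibres`: `ℙ²_ℂ` integral normal of finite
  type over `ℂ`, `X` integral, `f` proper).
* `levelZeroNets_of_fibredBySurfaces_pg_zero`, `levelZeroNets_of_pgZeroSurfaceFibration` — the item
  from either rendering of Cor. 1.5 (`GeometricallyConnected` / preconnected point-fibres). The item
  closes as soon as `Arapura2022_hodgeConjecture_pgZeroSurfaceFibration_holds` lands.
-/

set_option linter.dupNamespace false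

noncomputable section

namespace Summit.HodgeConjecture.HodgeConjecture.Theorems

namespace LevelZeroNetsStein

open CategoryTheory AlgebraicGeometry Limits
open Literature.AlgebraicGeometry.Motives Literature.AlgebraicGeometry.HodgeTheory

/-- **The local rings of a smooth projective complex variety are integrally closed** (smooth over
the normal scheme `Spec ℂ` is normal: `Resolution.isIntegrallyClosed_stalk_of_mem_smoothLocus`,
the smooth locus of `X → Spec ℂ` being everything). -/
theorem isIntegrallyClosed_stalk_of_isSmoothProjective {n : ℕ} {X : SchemeOver ℂ}
    (hX : IsSmoothProjective n X) (x : X.left) : IsIntegrallyClosed (X.left.presheaf.stalk x) := by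
  haveI : IsIntegral X.left := IsSmoothProjective.isIntegral_holds hX
  haveI := hX.smoothOfRelativeDimension
  haveI : Smooth X.hom := SmoothOfRelativeDimension.smooth n X.hom
  haveI : IsProper X.hom := IsSmoothProjective.isProper_holds hX
  haveI : Surjective X.hom :=
    ⟨fun y ↦ ⟨(IsIntegral.nonempty : Nonempty X.left).some, Subsingleton.elim _ _⟩⟩
  refine Literature.AlgebraicGeometry.Resolution.isIntegrallyClosed_stalk_of_mem_smoothLocus X.hom
    (fun s ↦ isIntegrallyClosed_stalk_Spec _ s) ?_
  rw [Scheme.Hom.smoothLocus_eq_top]; trivial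

/-- **The fibre over a closed point off `T` is preconnected.** For `f : X ⟶ ℙ²` whose fibres
`fiberOver f s` over the complex points `s` off `T` are smooth projective (geometrically
irreducible) surfaces, the point-fibre `f⁻¹{s}` over every closed point `s ∉ T` of `ℙ²` is
preconnected: closed points of `ℙ²_ℂ` are complex points (Nullstellensatz,
`ComplexPoints.equivClosedPoints`), and `f⁻¹{s.pt}` is the image of the irreducible scheme
`X ×_{ℙ²} Spec ℂ` (`Scheme.Pullback.range_fst`). -/
theorem isPreconnected_fibre_of_isSmoothProjective_fiberOver {X : SchemeOver ℂ}
    (f : X ⟶ projectiveSpace 2 ℂ) {T : Set (projectiveSpace 2 ℂ).left}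
    (hgen : ∀ s : AlgPoints (projectiveSpace 2 ℂ) ℂ, s.pt ∉ T →
      IsSmoothProjective 2 (fiberOver f s) ∧
        ∃ A : HodgeModel 2 (fiberOver f s), Module.finrank ℂ ↥(A.hodgePQ 2 2 0) = 0)
    (s : (projectiveSpace 2 ℂ).left) (hs : IsClosed ({s} : Set (projectiveSpace 2 ℂ).left))
    (hsT : s ∉ T) : _root_.IsPreconnected (f.left ⁻¹' {s}) := by
  have hP := isSmoothProjective_projectiveSpace_holds ℂ 2
  haveI := hP.smoothOfRelativeDimension
  haveI : Smooth (projectiveSpace 2 ℂ).hom := SmoothOfRelativeDimension.smooth 2 _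
  set s' : AlgPoints (projectiveSpace 2 ℂ) ℂ :=
    (ComplexPoints.equivClosedPoints (projectiveSpace 2 ℂ)).symm ⟨s, hs⟩ with hs'
  have hpt : s'.pt = s := by
    rw [← ComplexPoints.coe_equivClosedPoints_apply, hs', Equiv.apply_symm_apply]
  obtain ⟨hF, -⟩ := hgen s' (hpt ▸ hsT)
  haveI : IrreducibleSpace ↥(pullback f.left s'.left) := irreducibleSpace_of_isSmoothProjective' hF
  have hr : Set.range s'.toSpecHom = {s'.pt} :=
    Set.range_eq_singleton fun x ↦ by
      change s'.toSpecHom x = s'.toSpecHom (IsLocalRing.closedPoint ℂ)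
      rw [Subsingleton.elim x (IsLocalRing.closedPoint ℂ)]
  have hrange : Set.range (pullback.fst f.left s'.left) = f.left ⁻¹' {s} := by
    rw [Scheme.Pullback.range_fst, ← hpt]
    change f.left ⁻¹' Set.range s'.toSpecHom = _
    rw [hr]
  rw [← hrange]
  exact isPreconnected_range (pullback.fst f.left s'.left).continuous

/-- **All fibres of a net with smooth general fibres are geometrically connected.** For a smooth
projective complex fourfold `X` and a surjective `f : X ⟶ ℙ²` whose fibres over the complex points
off a proper Zariski-closed `T ⊆ ℙ²` are smooth projective surfaces, `f` has geometrically
connected fibres over every point of `ℙ²` (Stein factorisation / Zariski connectedness: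
`geometricallyConnected_of_isPreconnected_fibres` with `S = ℙ²_ℂ`, which is integral and normal,
`X` integral, `f` proper as `X` is proper and `ℙ²` separated over `ℂ`). -/
theorem geometricallyConnected_of_net {X : SchemeOver ℂ} (f : X ⟶ projectiveSpace 2 ℂ)
    (hX : IsSmoothProjective 4 X) (hf : Function.Surjective f.left)
    (hgen : ∃ T : Set (projectiveSpace 2 ℂ).left, IsClosed T ∧ T ≠ Set.univ ∧
      ∀ s : AlgPoints (projectiveSpace 2 ℂ) ℂ, s.pt ∉ T →
        IsSmoothProjective 2 (fiberOver f s) ∧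
          ∃ A : HodgeModel 2 (fiberOver f s), Module.finrank ℂ ↥(A.hodgePQ 2 2 0) = 0) :
    GeometricallyConnected f.left := by
  obtain ⟨T, hT, hTne, hgen⟩ := hgen
  have hP := isSmoothProjective_projectiveSpace_holds ℂ 2
  haveI : IsIntegral X.left := IsSmoothProjective.isIntegral_holds hX
  haveI : IsIntegral (projectiveSpace 2 ℂ).left := IsSmoothProjective.isIntegral_holds hP
  haveI : IsProper X.hom := IsSmoothProjective.isProper_holds hX
  haveI : IsProper (projectiveSpace 2 ℂ).hom := IsSmoothProjective.isProper_holds hP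
  haveI : IsProper f.left := by
    have : IsProper (f.left ≫ (projectiveSpace 2 ℂ).hom) := by rw [Over.w f]; infer_instance
    exact IsProper.of_comp f.left (projectiveSpace 2 ℂ).hom
  haveI : Surjective f.left := ⟨hf⟩
  exact geometricallyConnected_of_isPreconnected_fibres f.left (projectiveSpace 2 ℂ).hom
    (isIntegrallyClosed_stalk_of_isSmoothProjective hP) hT hTne
    (isPreconnected_fibre_of_isSmoothProjective_fiberOver f hgen)

end LevelZeroNetsStein

open Summit.HodgeConjecture.HodgeConjecture.Theses.NoetherLefschetzOneUp
open Literature.AlgebraicGeometry.Motives Literature.AlgebraicGeometry.HodgeTheory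

/-- **`LevelZeroNets` from Arapura 2022, Cor. 1.5** (the `GeometricallyConnected` rendering
`Arapura2022_hodgeConjecture_fourfold_fibredBySurfaces_pg_zero`): the item is that named fact at
`Y = ℙ²_ℂ` (smooth projective of dimension `2`, `isSmoothProjective_projectiveSpace_holds`), the
connectedness of ALL fibres being supplied by `LevelZeroNetsStein.geometricallyConnected_of_net`
(Zariski's connectedness theorem, proved), and the conclusion "algebraic" weakened to
"algebraic ⊔ vertical" (`span_le_sup`). CONDITIONAL on the named fact (a case of the Hodge
conjecture: Leray filtration, decomposition theorem — no carrier in the tree). -/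
theorem levelZeroNets_of_fibredBySurfaces_pg_zero
    (h : Arapura2022_hodgeConjecture_fourfold_fibredBySurfaces_pg_zero) : LevelZeroNets := by
  intro X f hX hf hgen
  exact Arapura2022_hodgeConjecture_fourfold_fibredBySurfaces_pg_zero.span_le_sup h f hX
    (isSmoothProjective_projectiveSpace_holds ℂ 2) hf
    (LevelZeroNetsStein.geometricallyConnected_of_net f hX hf hgen) hgen _

/-- **`LevelZeroNets` from Arapura 2022, Cor. 1.5** in the point-fibre rendering
`Arapura2022_hodgeConjecture_pgZeroSurfaceFibration` (the parent named fact with the split record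
`ArapuraSurfaceFibredFourfoldsSplit`): through
`Arapura2022_hodgeConjecture_fourfold_fibredBySurfaces_pg_zero.of_pgZeroSurfaceFibration`.
CONDITIONAL on that named fact; once `Arapura2022_hodgeConjecture_pgZeroSurfaceFibration_holds`
lands, `LevelZeroNets` follows unconditionally by this theorem. -/
theorem levelZeroNets_of_pgZeroSurfaceFibration
    (h : Arapura2022_hodgeConjecture_pgZeroSurfaceFibration) : LevelZeroNets :=
  levelZeroNets_of_fibredBySurfaces_pg_zero
    (Arapura2022_hodgeConjecture_fourfold_fibredBySurfaces_pg_zero.of_pgZeroSurfaceFibration h)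

/-- **The trust base, spelled out**: `LevelZeroNets` from the seven named-fact children of the
split record of Arapura's Cor. 1.5 (`Arapura2022_hodgeConjecture_pgZeroSurfaceFibration_holds_of`,
file `ArapuraSurfaceFibredFourfoldsSplit`): Lefschetz `(1,1)`, hard Lefschetz for fourfolds, the
Hodge conjecture in dimension `≤ 3`, existence of Hodge models, Deligne's Hodge III Cor. 8.2.8,
Voisin's 2025 Cor. 2.12, and Arapura's Thm. 1.2 on the smooth part of the fibration. CONDITIONAL on
exactly these; everything else (the connectedness of all fibres in particular) is proved. -/
theorem levelZeroNets_of_split_children (hL : lefschetzOneOne_rational)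
    (hHL : ∀ X : SchemeOver ℂ, nonempty_hardLefschetzNFold 4 X)
    (h3 : hodgeClasses_algebraic_of_dim_le_three)
    (hA : ∀ (m : ℕ) (Y : SchemeOver ℂ), nonempty_hodgeModel m Y)
    (hD : Deligne1974_ker_restrictCompl_eq_iSup_range_complexGysin)
    (hV : Voisin2025_hodgeClass_lift_complexGysin)
    (hVpart : Arapura2022_thm_1_2_smoothPart_pgZeroSurfaceFibration) : LevelZeroNets :=
  levelZeroNets_of_pgZeroSurfaceFibration
    (Arapura2022_hodgeConjecture_pgZeroSurfaceFibration_holds_of hL hHL h3 hA hD hV hVpart)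

end Summit.HodgeConjecture.HodgeConjecture.Theorems

/-! ## Appended (v2, prover c1): the item from the smooth part of the fibration alone

File III above derived `LevelZeroNets` from the named fact for the WHOLE of Arapura 2022, Cor. 1.5
(`Arapura2022_hodgeConjecture_pgZeroSurfaceFibration`, the Hodge conjecture for `X`; split record
`ArapuraSurfaceFibredFourfoldsSplit` with seven children: Lefschetz `(1,1)`, hard Lefschetz, the
conjecture in dimension `≤ 3`, Hodge models, Deligne's Cor. 8.2.8, Voisin's Cor. 2.12, and the
output of Thm. 1.2 on the smooth part `V = f⁻¹(Y ∖ T)`).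

This section shows that the item is — up to linear algebra over `ℚ` proved here — the LAST
child alone, `Arapura2022_thm_1_2_smoothPart_pgZeroSurfaceFibration` ("every rational
`(2,2)`-class of `X` agrees off some vertical divisor `f⁻¹T` with an algebraic class"), whose
conclusion has the item's "algebraic ⊔ vertical" shape; the vertical-to-algebraic step (Deligne +
Voisin + the conjecture for threefolds) that Cor. 1.5 needs on top is the SIBLING item
`VerticalHodgeAlgebraic` (`NoetherLefschetzOneUpVerticalHodgeAlgebraic`), not this one. The only
extra input is that algebraic classes are of Hodge type `(2,2)` (Grothendieck 1969: the coniveau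
inclusion `Grothendieck1969_supportedClasses_le_hodgeConiveau`, which the tree reduces to Deligne's
Cor. 8.2.8 by `Grothendieck1969_supportedClasses_le_hodgeConiveau_of_deligne` and the THEOREMS
`nonempty_hodgeModel_holds`, `exists_deRhamIsoFamily_holds`):

* `LevelZeroNetsDescent.exists_add_of_mem_span_union` — RATIONAL DESCENT (proved, any space): a
  rational class in the complex span of `S ∪ S'`, `S, S'` sets of rational classes, is `a + a'`
  with `a ∈ span S`, `a' ∈ span S'` both RATIONAL (`Hᵏ(Y; ℚ) ⊗ ℂ = Hᵏ(Y; ℂ)` on spans: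
  `ringChange_mem_span_image_iff`).
* `levelZeroNets_of_smoothPart` — `LevelZeroNets` from Grothendieck's coniveau inclusion and the
  `V`-part: the `V`-part gives `c = b + (c - b)` with `b` complex-algebraic and `c - b` dying off
  `f⁻¹T`; algebraic classes are spanned by rational algebraic classes
  (`supportedClasses_le_span_isRationalClass`, proved) and the kernel of the restriction by
  rational classes in the kernel (`mem_span_isRationalClass_of_map_eq_zero`, proved), so by
  rational descent `c = a + a'` with `a` rational algebraic and `a'` rational dying off `f⁻¹T`;
  and `a' = c - a` is of type `(2,2)` in the Hodge model of `c` because `a` is (coniveau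
  inclusion). The connectedness of all fibres required by the `V`-part is
  `LevelZeroNetsStein.geometricallyConnected_of_net` above.
* `levelZeroNets_of_deligne_smoothPart` — hence `LevelZeroNets` from EXACTLY two of the seven
  children: Deligne's Cor. 8.2.8 and the `V`-part. The item closes when both are discharged; the
  `V`-part (Leray filtration, decomposition theorem, relative Hilbert schemes — no carrier in the
  tree) is the one it hinges on.

The coniveau input cannot be dropped from a derivation of the item from the `V`-part as rendered
(`b` merely in the complex span of the algebraic classes): in a two-dimensional toy model with
"algebraic" and "vertical" two rational non-Hodge lines and a rational Hodge class on the
diagonal, the `V`-part's conclusion holds and the item's fails.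
-/

namespace Summit.HodgeConjecture.HodgeConjecture.Theorems

open CategoryTheory AlgebraicGeometry
open Literature.AlgebraicTopology.SingularHomology
open Literature.AlgebraicGeometry.Motives Literature.AlgebraicGeometry.HodgeTheory
open Summit.HodgeConjecture.HodgeConjecture.Theses.NoetherLefschetzOneUp

universe u

namespace LevelZeroNetsDescent

variable {Y : Type u} [TopologicalSpace Y] {k : ℕ}

/-- **Rational descent of a membership in a sum of two rationally generated spans.** For a
topological space `Y`, two sets `S, S'` of RATIONAL classes of `Hᵏ(Y; ℂ)` and a rational class
`c` in the complex span of `S ∪ S'`, there are RATIONAL classes `a ∈ span_ℂ S`, `a' ∈ span_ℂ S'`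
with `c = a + a'`. Proof: `S`, `S'`, `c` come from `Hᵏ(Y; ℚ)` along `ι = ringChange (ℚ → ℂ)`
(`IsRationalClass.exists_ringChange_eq`); `ι x ∈ span_ℂ ι(S₀ ∪ S₀')` forces
`x ∈ span_ℚ (S₀ ∪ S₀') = span_ℚ S₀ + span_ℚ S₀'` (`ringChange_mem_span_image_iff`: the injectivity
of `Hᵏ(Y; ℚ) ⊗ ℂ → Hᵏ(Y; ℂ)` on spans), and `ι` of the two summands are the required classes.
[cite: VoisinHodgeI2002, §7.1.1] [cite: HatcherAT2002, §3.1 p. 198] -/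
theorem exists_add_of_mem_span_union
    {S S' : Set (singularCohomology ℂ ℂ Y k)}
    (hS : ∀ x ∈ S, IsRationalClass x) (hS' : ∀ x ∈ S', IsRationalClass x)
    {c : singularCohomology ℂ ℂ Y k} (hc : IsRationalClass c)
    (hmem : c ∈ Submodule.span ℂ (S ∪ S')) :
    ∃ a a' : singularCohomology ℂ ℂ Y k, IsRationalClass a ∧ IsRationalClass a' ∧
      a ∈ Submodule.span ℂ S ∧ a' ∈ Submodule.span ℂ S' ∧ c = a + a' := by
  -- a set of rational classes is the image of its preimage under `Hᵏ(Y; ℚ) → Hᵏ(Y; ℂ)`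
  have hrange : ∀ {R : Set (singularCohomology ℂ ℂ Y k)}, (∀ x ∈ R, IsRationalClass x) →
      singularCohomology.ringChange (algebraMap ℚ ℂ) Y k ''
        (singularCohomology.ringChange (algebraMap ℚ ℂ) Y k ⁻¹' R) = R := fun hR ↦
    Set.image_preimage_eq_of_subset fun x hx ↦ (hR x hx).exists_ringChange_eq
  obtain ⟨x, rfl⟩ := hc.exists_ringChange_eq
  -- rational descent of the membership `ι x ∈ span_ℂ (S ∪ S')`
  have hx : x ∈ Submodule.span ℚ
      (singularCohomology.ringChange (algebraMap ℚ ℂ) Y k ⁻¹' S ∪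
        singularCohomology.ringChange (algebraMap ℚ ℂ) Y k ⁻¹' S') := by
    rw [← ringChange_mem_span_image_iff, span_ringChange_image_span, Set.image_union,
      hrange hS, hrange hS']
    exact hmem
  rw [Submodule.span_union, Submodule.mem_sup] at hx
  obtain ⟨y, hy, y', hy', rfl⟩ := hx
  refine ⟨_, _, isRationalClass_ringChange y, isRationalClass_ringChange y', ?_, ?_,
    map_add (singularCohomology.ringChange (algebraMap ℚ ℂ) Y k) y y'⟩
  · have h := ringChange_mem_span_image_of_mem_span hy
    rwa [hrange hS] at h
  · have h := ringChange_mem_span_image_of_mem_span hy'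
    rwa [hrange hS'] at h

end LevelZeroNetsDescent

/-- **`LevelZeroNets` from the smooth part of the fibration and Grothendieck's coniveau
inclusion.** Hypotheses: `hG` — classes supported in codimension `≥ s` have Hodge coniveau `≥ s`
in every Hodge model (Grothendieck 1969; for `(k, s) = (4, 2)`: algebraic classes of codimension
`2` are of type `(2,2)`); `hVpart` — Arapura 2022, Thm. 1.2 as applied in the proof of Cor. 1.5:
off a vertical divisor `f⁻¹T`, `T ⊊ Y` Zariski-closed, every rational `(2,2)`-class of the total
space of a `p_g = 0` surface fibration with connected fibres over a smooth projective surface `Y`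
agrees with an algebraic class. Proof: at `Y = ℙ²_ℂ` (`isSmoothProjective_projectiveSpace_holds`),
all fibres of the item's `f` are connected (`LevelZeroNetsStein.geometricallyConnected_of_net`,
Zariski/Stein, proved in file III; point-fibre form by
`isPreconnected_preimage_singleton_of_geometricallyConnected`); for a rational `(2,2)`-class `c`
the `V`-part gives an algebraic `b` with `c - b` dying off `f⁻¹T`; `b` is a complex combination of
RATIONAL algebraic classes (`supportedClasses_le_span_isRationalClass`) and `c - b` of RATIONAL
classes dying off `f⁻¹T` (`mem_span_isRationalClass_of_map_eq_zero`, rational classes spanning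
`H⁴(X(ℂ); ℂ)` by `span_isRationalClass_eq_top_of_isSmoothProjective_holds`), so by rational
descent (`LevelZeroNetsDescent.exists_add_of_mem_span_union`) `c = a + a'` with `a` rational
algebraic and `a'` rational dying off `f⁻¹T`; finally `a' = c - a` is of type `(2,2)` in the Hodge
model exhibiting `c` as a `(2,2)`-class, because `a` is (`hG`, `hodgeConiveau 4 2 = H^{2,2}`).
CONDITIONAL on the two named facts. [cite: Arapura2022, Thm. 1.2 and proof of Cor. 1.5 (p. 5)]
[cite: GrothendieckTopology1969, pp. 299–300] -/
theorem levelZeroNets_of_smoothPart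
    (hG : Grothendieck1969_supportedClasses_le_hodgeConiveau)
    (hVpart : Arapura2022_thm_1_2_smoothPart_pgZeroSurfaceFibration) : LevelZeroNets := by
  intro X f hX hf hgen
  have hconn : ∀ y : ↥(projectiveSpace 2 ℂ).left,
      _root_.IsPreconnected (f.left.base ⁻¹' {y}) :=
    isPreconnected_preimage_singleton_of_geometricallyConnected f
      (LevelZeroNetsStein.geometricallyConnected_of_net f hX hf hgen)
  obtain ⟨T, hT, hTne, hV⟩ :=
    hVpart f hX (isSmoothProjective_projectiveSpace_holds ℂ 2) hf hconn hgen
  refine Submodule.span_le.mpr ?_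
  rintro c ⟨hc, hc22⟩
  obtain ⟨b, hbA, hcb⟩ := hV c hc hc22
  -- the two rational generating sets: rational algebraic classes, and rational classes dying
  -- off `f⁻¹T`
  set SA : Set (complexBetti X (2 * 2)) :=
    {x | IsRationalClass x ∧ x ∈ algebraicClasses X 2} with hSA
  set SK : Set (complexBetti X (2 * 2)) :=
    {x | IsRationalClass x ∧
      complexBetti.restrictCompl X (f.left.base ⁻¹' T) (2 * 2) x = 0} with hSK
  have hb : b ∈ Submodule.span ℂ SA := supportedClasses_le_span_isRationalClass hX (2 * 2) 2 hbA
  have hk : c - b ∈ Submodule.span ℂ SK :=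
    mem_span_isRationalClass_of_map_eq_zero _
      (by rw [span_isRationalClass_eq_top_of_isSmoothProjective_holds 4 X hX (2 * 2)]
          exact Submodule.mem_top) hcb
  have hmem : c ∈ Submodule.span ℂ (SA ∪ SK) := by
    rw [Submodule.span_union]
    simpa only [add_sub_cancel] using Submodule.add_mem_sup hb hk
  -- rational descent: `c = a + a'`, `a` rational algebraic, `a'` rational dying off `f⁻¹T`
  obtain ⟨a, a', -, ha', haA, haK, rfl⟩ :=
    LevelZeroNetsDescent.exists_add_of_mem_span_union (fun x hx ↦ hx.1) (fun x hx ↦ hx.1) hc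
      hmem
  have haA' : a ∈ algebraicClasses X 2 :=
    (Submodule.span_le.mpr fun x hx ↦ hx.2 : Submodule.span ℂ SA ≤ algebraicClasses X 2) haA
  have haK' : complexBetti.restrictCompl X (f.left.base ⁻¹' T) (2 * 2) a' = 0 := by
    have hle : Submodule.span ℂ SK ≤
        LinearMap.ker (complexBetti.restrictCompl X (f.left.base ⁻¹' T) (2 * 2)).hom :=
      Submodule.span_le.mpr fun x hx ↦ hx.2
    exact hle haK
  refine Submodule.add_mem_sup haA' (Submodule.subset_span ⟨ha', ?_, T, hT, hTne, haK'⟩)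
  -- Hodge type `(2,2)` of `a' = (a + a') - a`: algebraic classes have Hodge coniveau `≥ 2` (`hG`)
  obtain ⟨A, hA⟩ := hc22
  refine ⟨A, ?_⟩
  have hpa : A.pullback (2 * 2) a ∈ A.hodgePQ (2 * 2) 2 2 := by
    have h1 : A.pullback (2 * 2) a ∈ A.hodgeConiveau (2 * 2) 2 :=
      hG hX A (2 * 2) 2 (Submodule.mem_map_of_mem haA')
    refine (?_ : A.hodgeConiveau (2 * 2) 2 ≤ A.hodgePQ (2 * 2) 2 2) h1
    refine iSup_le fun p ↦ iSup_le fun q ↦ iSup_le fun hpq ↦ iSup_le fun hp ↦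
      iSup_le fun hq ↦ ?_
    obtain ⟨rfl, rfl⟩ : p = 2 ∧ q = 2 := ⟨by omega, by omega⟩
    exact le_rfl
  have hsplit : A.pullback (2 * 2) a' = A.pullback (2 * 2) (a + a') - A.pullback (2 * 2) a := by
    rw [map_add, add_sub_cancel_left]
  rw [hsplit]
  exact Submodule.sub_mem _ hA hpa

/-- **`LevelZeroNets` from exactly two of the seven children of Arapura's Cor. 1.5**: Deligne's
Hodge III Cor. 8.2.8 (`Deligne1974_ker_restrictCompl_eq_iSup_range_complexGysin`) and the output of
Thm. 1.2 on the smooth part (`Arapura2022_thm_1_2_smoothPart_pgZeroSurfaceFibration`). Grothendieck's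
coniveau inclusion is the tree's PROVED reduction
`Grothendieck1969_supportedClasses_le_hodgeConiveau_of_deligne` fed with the THEOREMS
`nonempty_hodgeModel_holds` (Hodge models exist) and `exists_deRhamIsoFamily_holds` (de Rham). So,
compared with file III's `levelZeroNets_of_split_children`, Lefschetz `(1,1)`, hard Lefschetz,
the Hodge conjecture in dimension `≤ 3` and Voisin's Cor. 2.12 are NOT needed for this item: they
serve the vertical-to-algebraic step, which is the sibling item `VerticalHodgeAlgebraic`.
CONDITIONAL on the two named facts; the item closes by this theorem once both `_holds` land.
[cite: Arapura2022, Thm. 1.2 and proof of Cor. 1.5 (p. 5)] [cite: DeligneHodgeIII1974, Cor. 8.2.8] -/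
theorem levelZeroNets_of_deligne_smoothPart
    (hD : Deligne1974_ker_restrictCompl_eq_iSup_range_complexGysin)
    (hVpart : Arapura2022_thm_1_2_smoothPart_pgZeroSurfaceFibration) : LevelZeroNets :=
  levelZeroNets_of_smoothPart
    (Grothendieck1969_supportedClasses_le_hodgeConiveau_of_deligne hD
      (fun _ _ ↦ nonempty_hodgeModel_holds)
      fun E _ _ _ ↦ Literature.NumberTheory.Transcendental.exists_deRhamIsoFamily_holds E)
    hVpart

end Summit.HodgeConjecture.HodgeConjecture.Theorems

end
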